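import Literature.AlgebraicGeometry.Resolution.RsopMonomialIdeals
import HarnessLib

/-!
# Crux `Steer` (stmt-ResolutionOfSingularities-16345), chain W4.1 — hK4′ β-leaf WORDS: the projected polygon `(α, β, δ)` and the
# gauge / star values of res-L0-w41-idea-1's β-line, VERBATIM (K-β1♭ / K-β2♭ / K-β6 typers import this file)

OURS (campaign `res-hironaka`, rung L ★L-G4, slot W4.1; filed by res-L0-w41-stub-1 g4 as K-β1♭ owner, res-L0-w41-plan-1 RULINGS 140 /
143). VERBATIM copy of §1 (`AlphaGe DeltaGe BetaGe IsAlpha IsDelta IsBeta alphaGe_anti`; the §2 gauge words `IsGaugeRep AlphaStarGe DeltaStarGe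
IsDeltaStar IsVStar` follow in a companion file once res-L0-w41-idea-1 g10's «canonical cleaning» re-cut of the gauge is settled) of res-L0-w41-idea-1 g9's `L/res-L0-w41-idea-1/Sketch-idea-1-v17-betaleaf.lean` 0cadfc674714b12f (audited:
res-L0-w41-tri-2 `beta/audit_v15_betadebts.md` 0b5aa89a5a225197 §1–§2 «faithful, junk-free, intrinsic»); only the namespace differs
(`…Theorems.SwitchingDichotomy.BetaPolygon` instead of `…Cruxes.Steer.Ideas1.BetaDebts`), so that K-β1♭ (`PrepDebtHat`), K-β2♭ (hat letter
laws), K-β4 (`LegalityDebt`) and K-β6 (`SqModSqDescent`) can be typed Theses-free against ONE tree copy. The invariants are Hironaka's /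
Cossart–Jannsen–Saito's `δ, (α, β)` of the projected polyhedron `Δ(f ; (z,w) ; (x,y))` [CJS LNM 2270 Def. 11.1, (11.4); Cossart–Piltant,
arithm. II §9 Def. 9.4 in dim 3], TYPED INTRINSICALLY as memberships of `f` in MONOMIAL IDEALS of the regular parameters (the F-subset of
the polygon is an up-set); the gauge of the torsor `t² = f` (characteristic 2: cleaning `f ↦ f + q²`, preparation `z ↦ z + φ`, `w ↦ w + ψ`,
`φ, ψ ∈ (x, y)`) is quantified over; the STAR values are lexicographic sups over the gauge orbit. They replace the role of no printed item
and are NOT statements of the manuscript under review [claim: Hironaka2017, status: under-review]; AI review is weaker than expert review.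
Definitions only (plus the sanity lemma `alphaGe_anti`); no Theses import; nothing here is a route item or a registration.

Convention (idea-1 memo `BETA-BLOCK-g9.md` §1–§2): `Δ(f ; (z,w) ; (x,y)) ⊂ ℝ²` is generated by the points `(a, b)/(d − i − j)` of the
monomials `x^a y^b z^i w^j`, `i + j < d`, of an expansion of `f`; `α = min a`, `β = min {b : a = α}`, `δ = min (a + b)` (normalised). For
`ρ ≥ 0`: `α ≥ ρ ⟺ f ∈ (z,w)^d + Σ_{i+j<d} x^⌈ρ(d−i−j)⌉ z^i w^j`, `δ ≥ ρ ⟺ f ∈ (z,w)^d + Σ_{i+j<d} (x,y)^⌈ρ(d−i−j)⌉ z^i w^j`, and, GIVEN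
`α`, `β ≥ ρ ⟺ f ∈ (z,w)^d + Σ_{i+j<d} ( x^(⌊α(d−i−j)⌋+1) z^i w^j + x^⌈α(d−i−j)⌉ y^⌈ρ(d−i−j)⌉ z^i w^j )`. These are ideals of the ring
itself (no completion), and membership is expansion-independent. [cite: CossartJannsenSaito2020, Def. 11.1] [folklore]
-/

-- `Summit.<S>.<S>.…` duplicates the summit name by design (single-problem summit).
set_option linter.dupNamespace false
set_option autoImplicit false

open IsLocalRing

namespace Summit.ResolutionOfSingularities.ResolutionOfSingularities.Theorems.SwitchingDichotomy.BetaPolygon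

/-! ## §1 The projected polygon, intrinsically (VERBATIM idea-1 v17 §1) -/

section Polygon
variable {S : Type} [CommRing S]

/-- `α(f ; (z,w) ; x) ≥ ρ`. OURS. [folklore] -/
def AlphaGe (x z w : S) (d : ℕ) (ρ : ℚ) (f : S) : Prop :=
  f ∈ Ideal.span {z, w} ^ d ⊔
    ⨆ (i : ℕ) (j : ℕ) (_ : i + j < d), Ideal.span {x ^ ⌈ρ * ((d - i - j : ℕ) : ℚ)⌉₊ * z ^ i * w ^ j}

/-- `δ(f ; (z,w) ; (x,y)) ≥ ρ`. OURS. [folklore] -/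
def DeltaGe (x y z w : S) (d : ℕ) (ρ : ℚ) (f : S) : Prop :=
  f ∈ Ideal.span {z, w} ^ d ⊔
    ⨆ (i : ℕ) (j : ℕ) (_ : i + j < d), Ideal.span {x, y} ^ ⌈ρ * ((d - i - j : ℕ) : ℚ)⌉₊ * Ideal.span {z ^ i * w ^ j}

/-- `β ≥ ρ` on the column `a = α` (to be read together with `IsAlpha … α f`). OURS. [folklore] -/
def BetaGe (x y z w : S) (d : ℕ) (α ρ : ℚ) (f : S) : Prop :=
  f ∈ Ideal.span {z, w} ^ d ⊔
    ⨆ (i : ℕ) (j : ℕ) (_ : i + j < d),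
      (Ideal.span {x ^ (⌊α * ((d - i - j : ℕ) : ℚ)⌋₊ + 1) * z ^ i * w ^ j} ⊔
        Ideal.span {x ^ ⌈α * ((d - i - j : ℕ) : ℚ)⌉₊ * y ^ ⌈ρ * ((d - i - j : ℕ) : ℚ)⌉₊ * z ^ i * w ^ j})

/-- `α(f) = α` (a maximum: the abscissa of the left vertex). OURS. [folklore] -/
def IsAlpha (x z w : S) (d : ℕ) (α : ℚ) (f : S) : Prop :=
  AlphaGe x z w d α f ∧ ∀ ρ : ℚ, AlphaGe x z w d ρ f → ρ ≤ α

/-- `δ(f) = δ`. OURS. [folklore] -/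
def IsDelta (x y z w : S) (d : ℕ) (δ : ℚ) (f : S) : Prop :=
  DeltaGe x y z w d δ f ∧ ∀ ρ : ℚ, DeltaGe x y z w d ρ f → ρ ≤ δ

/-- `β(f) = β` given `α(f) = α` (the ordinate of the left vertex). OURS. [folklore] -/
def IsBeta (x y z w : S) (d : ℕ) (α β : ℚ) (f : S) : Prop :=
  BetaGe x y z w d α β f ∧ ∀ ρ : ℚ, BetaGe x y z w d α ρ f → ρ ≤ β

/-- The threshold predicates are antitone in `ρ` (sanity: the ideals grow as `ρ` decreases). [folklore] -/
theorem alphaGe_anti {x z w : S} {d : ℕ} {ρ ρ' : ℚ} (h : ρ ≤ ρ') {f : S} (hf : AlphaGe x z w d ρ' f) :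
    AlphaGe x z w d ρ f := by
  unfold AlphaGe at hf ⊢
  have key : ∀ i j : ℕ,
      Ideal.span ({x ^ ⌈ρ' * ((d - i - j : ℕ) : ℚ)⌉₊ * z ^ i * w ^ j} : Set S) ≤
        Ideal.span {x ^ ⌈ρ * ((d - i - j : ℕ) : ℚ)⌉₊ * z ^ i * w ^ j} := fun i j => by
    refine Ideal.span_singleton_le_span_singleton.mpr ?_
    refine mul_dvd_mul (mul_dvd_mul (pow_dvd_pow x (Nat.ceil_mono ?_)) (dvd_refl _)) (dvd_refl _)
    exact mul_le_mul_of_nonneg_right h (by positivity)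
  exact SetLike.le_def.mp (sup_le_sup_left (iSup_mono fun i => iSup_mono fun j => iSup_mono fun _ => key i j) _) hf

end Polygon

end Summit.ResolutionOfSingularities.ResolutionOfSingularities.Theorems.SwitchingDichotomy.BetaPolygon
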